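import Summits.BirchSwinnertonDyer.Rank1Residual.Additive.QuadraticBranchSignedMainConjecture
import Literature.NumberTheory.EllipticCurves.StrictSelmerRankOne
import Literature.NumberTheory.EllipticCurves.LeadingTermPPartProofs
import HarnessLib

/-!
# The ODD `η`-branch of a good supersingular twist is a STRICT-Selmer theory: Kobayashi's minus
# function `L_p⁻(V, η, X)` on the quadratic branch (pinned by (3.5) + (3.7)), the bottom-layer bound
# `ord_p #Sel_str(W/ℚ)[p^∞] ≤ ord_p (X⁻¹L_p⁻(V, η, X))(0)` (TYPED INPUT, theorem-shaped assembly of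
# printed theorems), and its rank-one consumers `⟹ BSD(W, p)` from two PER-PAIR CERTIFICATES with NO
# `p`-adic height (cell `b2b-bsdres`, lane CLASS-CLOSURE, seat cc-typer-6 GEN 5; class served: O7-ss ∩
# `e = 2`, NON-CM — transport lemma + verbatim-extension sub-class, handed to n1011 / cc-typer-2;
# NOT an O10 route — O10 class lead's RULING `HOME/class-closure/O10/RULING-ETA-ODD-STRICT-x1b.md`,
# v2 doc-only refresh of this file records it; statements unchanged)

HONEST FRAMING (cell `b2b-bsdres`, run/shared/lean/b2b/bsd-rank1-residual/, verbatim in every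
file): the goal of the cell is to DELETE the COMBINATION-SHAPED residual classes of the
Birch–Swinnerton-Dyer formula for ALL analytic-rank `≤ 1` elliptic curves over `ℚ` — "full BSD
formula for every rank `≤ 1` curve in class `C`" assembled STRICTLY from published theorems — so
that the rank-`≤ 1` remainder becomes exactly the CONSTRUCTION-SHAPED classes, which are TYPED
(missing-input `Prop`s), NOT attempted. This is not "finishing BSD". Lane CLASS-CLOSURE
(coordinator ruling 2026-08-21T04:07:19Z): research routes; no claim beyond the stated classes;
census / instrument output is EVIDENCE, never a Literature fact. This file: ONE interpolation
predicate and ONE abbreviation (definitions with bodies), THREE typed inputs (`@[conjecture] def`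
obligation nodes, NOTHING asserted: two theorem-shaped assemblies whose every ingredient is in print
but whose assembly is unwritten, one elementary lemma not yet in the kernel) and small PROVED
lemmas; the certificate sub-class and the consumers `⟹ BSD(W, p)` are the sibling file
`QuadraticBranchOddStrictSelmerCertificate.lean`. No named Literature fact is minted (net debt `0`);
no label of `RESIDUAL-MAP.md` moves; the class served (O7-ss ∩ `e = 2`, NON-CM) stays
CONSTRUCTION-SHAPED / OPEN; the per-pair certificates named here are INSTRUMENTATION (E4), never
coverage. SCOPE (O10 class lead's RULING `RULING-ETA-ODD-STRICT-x1b.md`, sha16 `a8bd8e04d6a47657`,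
2026-08-21T09:32Z, adopted): the chain below is an UPPER bound on `Ш` (Euler-system direction,
`Typed.MissingUpperBoundAt`); on O10 (X12, CM) it is NOT adopted — there the upper half is already
a kernel theorem for every pair (`X12/InertCoreUpperHalf.lean`, `InertCoreEveryCurve*`), all 995
O10 class pairs are decided per pair of record (T-MN19 / T-KR), the class residue is the LOWER half
(STEP L) and the node of record p255460 is unchanged; it is ENDORSED as new for O7-ss ∩ `e = 2` ∩
`r_an = 1` ∩ NON-CM with `ρ_{V,p^∞}` onto (ruling §3; the O7 owners' call).

## The observation (typer's route note `HOME/class-closure/O10/ROUTE-ETA-ODD-STRICT-typer6.md`,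
## locator-checked by rmap-3 GEN 11, RESIDUAL-MAP §F addendum 19 + LOCATOR CHECKS IX–X)

Frame of the sibling file `QuadraticBranchSignedMainConjecture.lean`: `p` odd, `p* = (−1)^{(p−1)/2} p`,
`η = χ_{p*} = ω^{(p−1)/2}` the quadratic character of `Δ = Gal(ℚ(μ_p)/ℚ)`, `W/ℚ` an elliptic curve
whose twist `V = W^{(p*)}` has GOOD reduction at `p` with `a_p(V) = 0` (so `W = V ⊗ η` is
additive, potentially supersingular, `e = 2` at `p`); Kobayashi, Invent. Math. 152 (2003), works
over `K_n = ℚ(ζ_{p^{n+1}})`, `K_{−1} = ℚ`, `K_∞ = ∪ K_n`, component by component in `η`.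
* §2 p. 4 (verbatim): "`E⁻(K_{n,v}) = {P ∈ E(K_{n,v}) | Tr_{n/m+1} P ∈ E(K_{m,v}) for odd m
  (−1 ≤ m < n)}`" — the MINUS condition carries the clause `m = −1`: `Tr_{n/0} P ∈ E(K_{−1,v}) =
  E(ℚ_p)`. At `n = 0` this says `E⁻(K_{0,v}) = E(ℚ_p)`, which is FIXED by `Δ`; hence for `η ≠ 1`
  the `η`-part of the local condition at `p` is ZERO and
  `Sel⁻(V/K_0)^η = (strict-at-p Selmer group of V over K_0)^η ≅ Sel_str(W/ℚ)[p^∞]`, the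
  `p`-STRICT Selmer group of the twist — the tree's
  `W.selmerGroupPInfty p ⊓ selmerLocalKerPrimaryTorsion W ℚ_[p] p` (`StrictSelmerRankOne.lean`) —
  by `η`-isotypic restriction (`p ∤ [K_0 : ℚ]`, `W[p^∞] ≅ V[p^∞] ⊗ η`, the local conditions at
  `ℓ ≠ p` are "locally trivial in `H¹(·, E[p^∞])`" on both sides). [dictionary: folklore; flag
  `Kob03-eta-twist-dictionary`]
* (3.5), (3.7) p. 7: Pollack's `L_p⁻(E, η, X)` is characterised by its values at `ζ − 1` for the
  characters `ψ = ηχ` of conductor `p^{n+1}`, `n` ODD: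
  `L_p⁻(E, η, ζ − 1) = (−1)^{(n+1)/2} (p^{n+1}/τ(ψ)) (∏_{even k ≤ n} Φ_k(ζ))^{−1} L(E, ψ̄, 1)/Ω_E^δ`,
  and `L_p⁻(E, η, 0) = 0` for `η ≠ 1` (3.7).
* §4 p. 8 (verbatim): "Conjecture (Odd main conjecture). … If `η` is non-trivial, we have
  `Char(X⁻(E/K_∞)^η) = (X⁻¹ L_p⁻(E, η, X))`. (By (3.7), the `p`-adic `L`-function `L_p⁻(E, η, X)`
  is divisible by `X`.) **Theorem 4.1.** There exists an integer `n ≥ 0` such that …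
  `Char(X⁻(E/K_∞)^η) ⊇ (pⁿ X⁻¹ L_p⁻(E, η, X))` for `η ≠ 1`. If the `p`-adic representation
  `Gal(ℚ̄/ℚ) → GL_{ℤ_p}(T)` is surjective, then we can take `n = 0`."
* Lemma 9.1 p. 25: "`Sel^±(E/K_n) → Sel^±(E/K_∞)` are injective" (`E(K_∞)[p^∞] = 0`) — the ONLY
  control statement the chain below uses (at `n = 0`); Thm. 9.3 p. 26 (control modulo the
  polynomials `ω_n^±`, `ω̃⁻_n` of the odd levels, finite kernels of bounded order) is NOT needed: at
  the bottom of the odd `η`-branch the layer-`0` group IS the strict group; Thm. 7.4 p. 13: Kato's,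
  the even and the odd main conjectures are equivalent, `η`-component by `η`-component (three
  exact sequences, the last "for a non-trivial `η`").
* Kitajima–Otsuki, Tokyo J. Math. 41 (2018), Main Thm. 1.3 (arXiv:1607.03612 p. 3, verbatim in the
  tree fact `KitajimaOtsuki2018.mainThm13_plusSelmerDual_noFiniteSubmodule`, which transcribes the
  sign `+` only): for `F_0 = ℚ(μ_p)` and `a_p = 0`, BOTH `Sel^±(F_∞, E[p^∞])^∨` (Def. 2.1 with
  "`for all odd m, −1 ≤ m ≤ n−1`" for the sign `−`, p. 6) have no nontrivial finite `Λ`-submodule.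
Consequence (the chain (1)–(5) of the route note; every arrow PRINT or standard): for
`ρ_{V,p^∞}` surjective, with `f_η` a characteristic power series of `X^{−,η} := X⁻(V/K_∞)^η`
(torsion, Thm. 2.2): `f_η ∣ X⁻¹L_p⁻(V, η, X)` (Thm. 4.1, `n = 0`); if `(X⁻¹L_p⁻)(0) ≠ 0` then
`f_η(0) ≠ 0`, `X^{−,η}[T]` is finite hence `0` (KO18), `#(X^{−,η})_Γ = p^{v_p(f_η(0))}`
(Greenberg LNM 1716 Lemma 4.2, tree `constantCoeff_charGenerator_mul_natCard_invariants`),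
`Sel_str(W/ℚ)[p^∞] = Sel⁻(V/K_0)^η ↪ (Sel⁻(V/K_∞)^η)^Γ` (Lemma 9.1), so
**`Sel_str(W/ℚ)[p^∞]` is finite and `ord_p #Sel_str(W/ℚ)[p^∞] ≤ v_p((X⁻¹L_p⁻(V, η, X))(0))`** —
the exact odd-branch twin of the tree's PROVED plus-sign inequality
`SignedControlZero.padicValNat_card_selmerGroupPInfty_le` (file `SignedSelmerControlZero.lean`,
line V18 at `p = 3`), with the STRICT-minus object in place of `SignedSelmerDualData`.
And then, ELEMENTARY: if `W(ℚ)` has a point of infinite order, every class of `Ш(W)[p^∞]` has a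
strict representative (`W(ℚ) ⊗ ℚ_p/ℤ_p → W(ℚ_p) ⊗ ℚ_p/ℤ_p ≅ ℚ_p/ℤ_p` is onto), so
`#Ш(W)[p^∞] ∣ #Sel_str(W/ℚ)[p^∞]`; in analytic rank one (GZK) this gives
`ord_p #Ш(W) ≤ v_p((X⁻¹L_p⁻(V, η, X))(0))` with NO `p`-adic height, NO Schneider hypothesis and NO
Gross–Zagier formula on the branch (the "regulator" of the odd branch is `log_ω(P)²`, automatically
non-zero: Kurihara–Pollack 2007 p. 351 L16, §1.5). On the pairs where the PER-PAIR CERTIFICATES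
`(X⁻¹L_p⁻(V, η, X))(0) ∈ ℤ_p^×` (odd branch `(μ, λ) = (0, 1)`) and `ord_p #Ш(W)_an = 0` hold,
this is `BSD(W, p)` EXACTLY.

## Why the objects are TYPED INPUTS here and not kernel theorems / Literature facts (yet)

The tree's signed Selmer vocabulary `Kobayashi2003/SignedSelmer.lean` (`signedLocalPointsOfEmb`,
`SignedSelmerDualData W κ γ ε`) implements Def. 2.1's conditions for `0 ≤ m < n` ONLY — no
condition at `n = 0` (`signedLocalPointsOfEmb_zero`), its docstring naming the `−1 ≤ m` variant as
not implemented — and carries no `Δ`-action; so neither `X⁻(V/K_∞)^η` nor the printed Thm. 4.1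
(odd, `η ≠ 1`) can be transcribed today (the plus sign was: `η = 1` over `ℚ_∞` A-fact
`Kobayashi2003.thm41_signedCharIdeal_divisibility`, `p = 3` over `ℚ(ζ₃)`
`thm41_plusCharIdeal_dvd_cyclotomicThree`, the quadratic branch by `Δ'`-descent in the sibling
file). PROVER TARGETS that turn §3's inputs into theorems (named for the class teams):
(P1) `strictSignedLocalPoints` = `signedLocalPointsOfEmb (−1) n ⊓ {P | Tr_{n/0} P ∈ E(K_{−1,v})}`
over `K_n = ℚ(ζ_{p^{n+1}})` (equivalently, in `W`-coordinates over the cyclotomic `ℤ_p`-extension of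
`ℚ`: the tree's minus condition on `W(ℚ_{n,p})` plus "`Tr_{n/0} P` torsion", since
`(V̂(k_n))^η = W(ℚ_{n,p}) ⊗ ℤ_p` and `V̂(ℚ_p)^η = 0`) with its dual datum; (P2) the Literature
transcription of Kobayashi Thm. 4.1 (odd, `η ≠ 1`) and of KO18 Main Thm. 1.3 (sign `−`) on (P1);
(P3) the chain above = `SignedControlZero` verbatim on (P1); (P4) the elementary lemma §4 next to
`finite_strictSelmer_of_mordellWeilRank_eq_one`. Until then §3–§4 are INPUTS (explicit hypotheses
of every consumer theorem of the sibling file), exactly as the lane types unwritten assemblies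
(`QuadraticBranchLower`, `CongruentPartnerBudgetSchema`); nothing is asserted.

## Contents

* §1 `IsQuadraticBranchMinusLFunction f p ϖ L` — Kobayashi's `L_p⁻(V, η, X)` on the quadratic
  branch, pinned by (3.5) (odd `n`) in Birch's currency + the clause (3.7) `L(0) = 0`; unfolding;
  `X ∣ L` (PROVED), so `(X⁻¹L)(0) = coeff₁ L`.
* §2 `strictSelmerPInfty W p` — the tree's `p`-strict Selmer group `Sel_str(W/ℚ)[p^∞]` (abbrev) and
  its finiteness in rank one (tree theorem, re-exported).
* §3 TYPED INPUTS: `QuadraticBranchOddStrictSelmerBoundAt W p` (surjective `ρ_{V,p^∞}`; Thm. 4.1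
  `n = 0`) and `QuadraticBranchOddStrictSelmerBoundOfPlusMCAt W p` (no image hypothesis; instead the
  sibling's (C1_η) `QuadraticBranchPlusMainConjectureAt V p`, through Thm. 7.4 even ⟺ odd at `η` —
  the image-free CONDITIONAL form for twins whose `p`-adic image is not onto, where Thm. 4.1's `n` is
  not effective; NOT an O10 route, see SCOPE above).
* §4 TYPED INPUT (elementary): `StrictSelmerDominatesShaAt W p`.
* sibling `QuadraticBranchOddStrictSelmerCertificate.lean`: the sub-class predicate
  `OddBranchUnitCertificateAt W p` (the odd-branch function of the good twist has `(μ, λ) =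
  (0, 1)`) and the PROVED consumers: inputs + certificate + `ord_p #Ш_an(W) = 0` + `r_an(W) = 1` ⟹
  `BSDp W p`, in both forms (the EVIDENCE lines of the E1-η census are quoted there).

References: [Kobayashi2003] §2 p. 4 (the `m = −1` clause), Def. 2.1 + Thm. 2.2 (p. 5), §3 p. 5,
Thm. 3.2, (3.5), (3.7) (p. 7), §4 Odd main conjecture + Thm. 4.1 (p. 8), Thm. 7.4 (p. 13), Lemma 9.1
(p. 25), Thm. 9.3 (p. 26) — corpus `paper:doi-10-1007-s00222-002-0265-4`; [KitajimaOtsuki2018] Main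
Thm. 1.3, Def. 2.1 (arXiv:1607.03612 pp. 3, 6); [GreenbergLNM1716] Lemma 3.1, Lemma 4.2;
[KuriharaPollack2007] §1.5 (p. 361), p. 351; [MazurTateTeitelbaum1986Invent] §I.8 (8.6);
[PollackRubin2004] p. 448 (CM remark); [Miller2011LMS] Def. 1.1; [Darmon2004] Thm. 3.22;
[Skinner2020] §2.2 (the strict group in rank one).
-/

noncomputable section

open scoped Classical MatrixGroups ModularForm

open CongruenceSubgroup Polynomial WeierstrassCurve Literature.NumberTheory.EllipticCurves
  Literature.NumberTheory.EllipticCurves.ModularForms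
  Literature.NumberTheory.EllipticCurves.Kobayashi2003
  Literature.NumberTheory.EllipticCurves.Rank1Residual
  Literature.NumberTheory.EllipticCurves.Rank1Residual.Typed
  Literature.NumberTheory.GaloisRepresentations ZpExtension

namespace Summit.BirchSwinnertonDyer.Rank1Residual.Additive

/-! ## §1 Kobayashi's `L_p⁻(V, η, X)` on the quadratic branch, pinned by (3.5) + (3.7) -/

section BranchFunction

variable {N : ℕ} (f : CuspForm (Gamma0 N) 2) (p : ℕ) [Fact p.Prime]

/-- **`L` is Kobayashi's MINUS function `L_p⁻(V, η, X)` on the quadratic branch `η = ω^{(p−1)/2}`,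
up to a `p`-adic unit** (`f` the newform of `V`, `ϖ` the period ratio of the parity `δ = η(−1)` of
`η`: `ϖ·Ω_V = Ω⁺_f` if `p ≡ 1 (mod 4)`, `ϖ·|Ω⁻(V)| = Ω⁻_f` if `p ≡ 3 (mod 4)`): (i) `L(0) = 0`
— Kobayashi's (3.7) "`L_p⁻(E, η, 0) = 0`" for `η ≠ 1` (so `X ∣ L` and the odd main conjecture is
stated with `X⁻¹L`); (ii) there is `u ∈ ℤ_p^×` such that for every ODD `n ≥ 1` and every Dirichlet
character `ψ` mod `p^{n+1}` of order `2pⁿ` (i.e. `ψ = ηχ`, `χ` of conductor `p^{n+1}` and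
`p`-power order), with `ζ = ψ(1 + p)`:
`L(ζ − 1) · ω_n⁺(ζ − 1) = (−1)^{(n+1)/2} u ϖ ∑_{a mod p^{n+1}} ψ(a)[a/p^{n+1}]^δ_f` in `ℂ_p` —
Kobayashi's (3.5) "`L_p⁻(E, η, ζ − 1) = (−1)^{(n+1)/2} (p^{n+1}/τ(ψ)) (∏_{even k ≤ n} Φ_k(ζ))^{−1}
L(E, ψ̄, 1)/Ω_E^δ`" through Birch's formula (`τ(ψ)τ(ψ̄) = ψ(−1)p^{n+1}`; tree
`ratTwistedSymbolSum` / `ratMinusTwistedSymbolSum`, Mazur–Tate–Teitelbaum (8.6)) and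
`ω_n⁺ = ∏_{1 ≤ 2k ≤ n} Φ_{p^{2k}}(1 + T)` (tree `cyclotomicOmegaPlus`). The EXACT twin of the
sibling's `IsQuadraticBranchPlusLFunction` ((3.4), even `n`, `ω_n⁻`): same dictionary, same flag
`Kob03-Lminus-eta-upto-unit` (Néron `Ω_V^δ` versus `Ω^δ_f`, a sign and a power of `2` absorbed in
`u`). Such an `L` is unique up to `ℤ_p^×` (infinitely many interpolation points in the open disc);
it exists by Kobayashi's Thm. 3.2 (Pollack) with (3.7), a theorem in print NOT vendored here (every
statement below quantifies over all such `L`). A predicate.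
[cite: Kobayashi2003, Thm. 3.2, (3.5) and (3.7) (p. 7); §3 (p. 5) for the variable γ ↦ 1 + X]
[cite: MazurTateTeitelbaum1986Invent, §I.8 (8.6)] -/
def IsQuadraticBranchMinusLFunction (ϖ : ℚ) (L : IwasawaAlgebra p) : Prop :=
  PowerSeries.constantCoeff L = 0 ∧
  ∃ u : ℤ_[p]ˣ, ∀ n : ℕ, Odd n →
    ∀ ψ : DirichletCharacter ℂ_[p] (p ^ (n + 1)), orderOf ψ = 2 * p ^ n →
      HasSum
        (fun k : ℕ ↦ ((algebraMap ℚ_[p] ℂ_[p]).comp (algebraMap ℤ_[p] ℚ_[p]))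
            (PowerSeries.coeff k L) *
          (ψ (cyclotomicGenerator p : ZMod (p ^ (n + 1))) - 1) ^ k)
        ((-1 : ℂ_[p]) ^ ((n + 1) / 2) *
            algebraMap ℚ_[p] ℂ_[p] (((u : ℤ_[p]) : ℚ_[p]) * (ϖ : ℚ_[p])) *
            (if Even (p / 2) then ratTwistedSymbolSum f ψ else ratMinusTwistedSymbolSum f ψ) /
          (cyclotomicOmegaPlus p n).eval₂ (algebraMap ℤ ℂ_[p])
            (ψ (cyclotomicGenerator p : ZMod (p ^ (n + 1))) - 1))

/-- Unfolding lemma. [cite: Kobayashi2003, (3.5) and (3.7) (p. 7)] -/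
theorem isQuadraticBranchMinusLFunction_iff (ϖ : ℚ) (L : IwasawaAlgebra p) :
    IsQuadraticBranchMinusLFunction f p ϖ L ↔
      PowerSeries.constantCoeff L = 0 ∧
      ∃ u : ℤ_[p]ˣ, ∀ n : ℕ, Odd n →
        ∀ ψ : DirichletCharacter ℂ_[p] (p ^ (n + 1)), orderOf ψ = 2 * p ^ n →
          HasSum
            (fun k : ℕ ↦ ((algebraMap ℚ_[p] ℂ_[p]).comp (algebraMap ℤ_[p] ℚ_[p]))
                (PowerSeries.coeff k L) *
              (ψ (cyclotomicGenerator p : ZMod (p ^ (n + 1))) - 1) ^ k)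
            ((-1 : ℂ_[p]) ^ ((n + 1) / 2) *
                algebraMap ℚ_[p] ℂ_[p] (((u : ℤ_[p]) : ℚ_[p]) * (ϖ : ℚ_[p])) *
                (if Even (p / 2) then ratTwistedSymbolSum f ψ else ratMinusTwistedSymbolSum f ψ) /
              (cyclotomicOmegaPlus p n).eval₂ (algebraMap ℤ ℂ_[p])
                (ψ (cyclotomicGenerator p : ZMod (p ^ (n + 1))) - 1)) :=
  Iff.rfl

variable {f p}

/-- (3.7): the constant term vanishes. [cite: Kobayashi2003, (3.7) (p. 7)] -/
theorem IsQuadraticBranchMinusLFunction.constantCoeff_eq_zero {ϖ : ℚ} {L : IwasawaAlgebra p}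
    (h : IsQuadraticBranchMinusLFunction f p ϖ L) : PowerSeries.constantCoeff L = 0 :=
  h.1

/-- **`X ∣ L_p⁻(V, η, X)`** ("By (3.7), the `p`-adic `L`-function `L_p⁻(E, η, X)` is divisible by
`X`", §4 p. 8): `L = X · L'` with `L'(0) = coeff₁ L` — so the generator `X⁻¹L_p⁻(V, η, X)` of the
printed odd main conjecture has constant term `coeff₁ L`. PROVED (power-series algebra).
[cite: Kobayashi2003, §4 (p. 8, parenthesis after the Odd main conjecture)] -/
theorem IsQuadraticBranchMinusLFunction.exists_eq_X_mul {ϖ : ℚ} {L : IwasawaAlgebra p}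
    (h : IsQuadraticBranchMinusLFunction f p ϖ L) :
    ∃ L' : IwasawaAlgebra p, L = PowerSeries.X * L' ∧
      PowerSeries.constantCoeff L' = PowerSeries.coeff 1 L := by
  have hX : PowerSeries.X ∣ L := PowerSeries.X_dvd_iff.mpr h.1
  obtain ⟨L', hL'⟩ := hX
  refine ⟨L', hL', ?_⟩
  have := congrArg (PowerSeries.coeff 1) hL'
  rw [PowerSeries.coeff_succ_X_mul, PowerSeries.coeff_zero_eq_constantCoeff] at this
  exact this.symm

end BranchFunction

/-! ## §2 The `p`-strict Selmer group `Sel_str(W/ℚ)[p^∞]` (tree object) -/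

section Strict

variable (W : WeierstrassCurve ℚ) (p : ℕ) [Fact p.Prime]

/-- **`Sel_str(W/ℚ)[p^∞] = Sel_{p^∞}(W/ℚ) ∩ ker (H¹(ℚ, W[p^∞]) → H¹(ℚ_p, W[p^∞]))`**, the
`p`-STRICT (locally-trivial-at-`p`) Selmer group — the tree's object of
`finite_strictSelmer_of_mordellWeilRank_eq_one` (`StrictSelmerRankOne.lean`; Skinner 2020 §2.2,
C.-H. Kim 2022 §1) and, by the `η`-twist dictionary, the bottom layer `Sel⁻(V/ℚ(μ_p))^η` of
Kobayashi's ODD Selmer group of the good twist `V = W^{(p*)}` on the component `η = ω^{(p−1)/2}`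
(the `m = −1` clause of §2 p. 4 kills the local condition at `p` on `η ≠ 1`). An abbreviation.
[cite: Skinner2020, §2.2 (Lemma rank1lemma and the preceding paragraph)]
[cite: Kobayashi2003, §2 (p. 4: E⁻ with −1 ≤ m < n, K_{−1} = ℚ) and Def. 2.1 (p. 5)] -/
abbrev strictSelmerPInfty : AddSubgroup (W.galH1Primary p) :=
  W.selmerGroupPInfty p ⊓ selmerLocalKerPrimaryTorsion W ℚ_[p] p

/-- Unfolding (definitional). [cite: Skinner2020, §2.2] -/
theorem strictSelmerPInfty_def :
    strictSelmerPInfty W p = W.selmerGroupPInfty p ⊓ selmerLocalKerPrimaryTorsion W ℚ_[p] p :=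
  rfl

/-- **In rank one with finite `Ш[p^∞]`, `Sel_str(W/ℚ)[p^∞]` is finite** — the tree theorem
`finite_strictSelmer_of_mordellWeilRank_eq_one` (Skinner 2020 §2.2 / C.-H. Kim 2022 §1), re-exported
on the abbreviation: on the odd `η`-branch the rank-one generator is invisible to the strict
condition (it contributes only the finite index `p^ν` of its `p`-divisibility in `W(ℚ_p)/tors`),
which is why the group is finite although `rank W(ℚ) = 1`.
[cite: Skinner2020, §2.2 (Lemma rank1lemma) and §3] [cite: Kobayashi2003, §2 (p. 4) and Lemma 9.1 (p. 25)] -/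
theorem finite_strictSelmerPInfty_of_mordellWeilRank_eq_one [W.IsElliptic]
    (hrank : W.mordellWeilRank = 1) [Finite (AddCommGroup.primaryComponent W.sha p)] :
    Finite ↥(strictSelmerPInfty W p) :=
  finite_strictSelmer_of_mordellWeilRank_eq_one W p hrank

end Strict

/-! ## §3 TYPED INPUTS: the bottom-layer bound of the odd `η`-branch (theorem-shaped assemblies) -/

/-- **TYPED INPUT (theorem-shaped ASSEMBLY of printed theorems; the assembly is UNWRITTEN; nothing
asserted): the odd-`η`-branch STRICT-Selmer bound for surjective `ρ_{V,p^∞}`.** For `W/ℚ` globally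
minimal, `p` odd, `V` a globally minimal model of the twist `W^{(p*)}` (`C • W.quadraticTwist p* =
V`) with good reduction at `p` and `a_p(V) = 0`, `Gal(ℚ̄/ℚ) → GL_{ℤ_p}(T_pV)` surjective (as in
the tree's Thm. 4.1 transcriptions: `∀ m, V.HasSurjectiveModNGaloisRep (p^m)`), `f` the newform of
`V`, `ϖ` the period ratio of the parity of `η`, and `Lη` ANY function with the interpolation
property of `L_p⁻(V, η, X)` (§1): **if `coeff₁ Lη = (X⁻¹Lη)(0) ≠ 0` then `Sel_str(W/ℚ)[p^∞]` is
finite and `ord_p #Sel_str(W/ℚ)[p^∞] ≤ v_p(coeff₁ Lη)`.** Intended proof (route note §3 (1)–(5);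
each step a printed theorem or standard): Kobayashi 2003 Thm. 4.1, odd sign, `η ≠ 1`, `n = 0`
(`Char X⁻(V/K_∞)^η ∋ X⁻¹L_p⁻(V, η, X)`) + Thm. 2.2 (torsion) + Kitajima–Otsuki 2018 Main Thm. 1.3,
sign `−` (no finite submodule ⟹ `X^{−,η}[T] = 0`) + Greenberg Lemma 4.2
(`f(0) = u·#(X/TX)`, tree `SignedControlZero.exists_constantCoeff_eq_unit_mul_natCard_coinvariants`)
+ Lemma 9.1 at `n = 0` (`Sel⁻(V/K_0)^η ↪ (Sel⁻(V/K_∞)^η)^Γ`, `E(K_∞)[p^∞] = 0`) + the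
`η`-twist dictionary `Sel⁻(V/K_0)^η = Sel_str(W/ℚ)[p^∞]` (the `m = −1` clause). It is the odd-branch
twin of the PROVED `SignedControlZero.padicValNat_card_selmerGroupPInfty_le`; it becomes a kernel
theorem once the strict-minus signed Selmer structure (P1) and the transcriptions (P2) exist (module
docstring). Label: THEOREM-SHAPED, ASSEMBLY UNWRITTEN; typed as an input; the classes it serves stay
OPEN. [cite: Kobayashi2003, Thm. 4.1 and §4 Odd main conjecture (p. 8), §2 (p. 4), Thm. 2.2 (p. 5), Lemma 9.1 (p. 25), Thm. 9.3 (p. 26)]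
[cite: KitajimaOtsuki2018, Main Thm. 1.3 (= Thm. 4.8) with Def. 2.1 (arXiv:1607.03612 pp. 3, 6)]
[cite: GreenbergLNM1716, §3 Lemma 3.1 (p. 86) and §4 Lemma 4.2 (p. 102)] -/
@[conjecture] def QuadraticBranchOddStrictSelmerBoundAt (W : WeierstrassCurve ℚ) [W.IsElliptic]
    [W.IsGloballyMinimal] (p : ℕ) [Fact p.Prime] : Prop :=
  ∀ (V : WeierstrassCurve ℚ) [V.IsElliptic] [V.IsGloballyMinimal] (C : VariableChange ℚ)
    {N : ℕ} [NeZero N] {f : CuspForm (Gamma0 N) 2},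
    p ≠ 2 → C • W.quadraticTwist ((-1) ^ (p / 2) * p) = V →
    V.HasGoodReductionAtPrime p → V.frobeniusTrace p = 0 →
    (∀ m : ℕ, V.HasSurjectiveModNGaloisRep (p ^ m : ℕ)) →
    IsNewformOf V f →
    ∀ (ϖ : ℚ), (if Even (p / 2) then (ϖ : ℝ) * V.realPeriodRat = plusPeriod f
        else (ϖ : ℝ) * V.imaginaryPeriodRat = minusPeriod f) →
    ∀ (Lη : IwasawaAlgebra p), IsQuadraticBranchMinusLFunction f p ϖ Lη →
    PowerSeries.coeff 1 Lη ≠ 0 →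
    Finite ↥(strictSelmerPInfty W p) ∧
      (padicValNat p (Nat.card ↥(strictSelmerPInfty W p)) : ℤ) ≤
        ((PowerSeries.coeff 1 Lη : ℤ_[p]) : ℚ_[p]).valuation

/-- **TYPED INPUT (theorem-shaped ASSEMBLY; nothing asserted): the same bound WITHOUT the image
hypothesis, from the sibling's typed (C1_η) `QuadraticBranchPlusMainConjectureAt V p`** (Kobayashi's
EVEN main conjecture for `V` at `η = ω^{(p−1)/2}`, read over `ℚ(√p*)`; CONJECTURE IN PRINT; for
CM `V` "provable with the same proof", Pollack–Rubin 2004 p. 448, a REMARK) through Thm. 7.4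
("Kato's main conjecture, the even main conjecture and the odd main conjecture are equivalent",
`η`-component by `η`-component: the three exact sequences of its proof, the last "for a non-trivial
`η`") — so `Char X^{−,η} = (X⁻¹L_p⁻(V, η, X))` EXACTLY and the chain of
`QuadraticBranchOddStrictSelmerBoundAt` runs with no `pⁿ`. This is the image-free CONDITIONAL form
for twins `V` whose `p`-adic image is NOT onto (Thm. 4.1's integer `n` not effective) — recorded for
the NON-CM non-surjective twins of O7-ss ∩ `e = 2`; it is NOT an O10 route (O10 class lead's ruling,
module docstring SCOPE: on the CM class the conclusion is already decided per pair of record and the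
class residue is the lower half; for CM `V` at `𝔭` under Rubin's condition (b) the ruling notes that
Kato, Astérisque 295 §15 Prop. 15.17 / 15.21 even give Thm. 4.1 with `n = 0` by a one-sentence
combination). Label: THEOREM-SHAPED modulo the typed (C1_η); ASSEMBLY UNWRITTEN; typed as an input.
[cite: Kobayashi2003, Thm. 7.4 (p. 13), §4 (p. 8), Lemma 9.1 (p. 25)]
[cite: PollackRubin2004, Theorem and the remark on Sel over ℚ(μ_{p^∞}) (p. 448)]
[cite: KitajimaOtsuki2018, Main Thm. 1.3 (arXiv:1607.03612 p. 3)] -/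
@[conjecture] def QuadraticBranchOddStrictSelmerBoundOfPlusMCAt (W : WeierstrassCurve ℚ) [W.IsElliptic]
    [W.IsGloballyMinimal] (p : ℕ) [Fact p.Prime] : Prop :=
  ∀ (V : WeierstrassCurve ℚ) [V.IsElliptic] [V.IsGloballyMinimal] (C : VariableChange ℚ)
    {N : ℕ} [NeZero N] {f : CuspForm (Gamma0 N) 2},
    p ≠ 2 → C • W.quadraticTwist ((-1) ^ (p / 2) * p) = V →
    V.HasGoodReductionAtPrime p → V.frobeniusTrace p = 0 →
    QuadraticBranchPlusMainConjectureAt V p →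
    IsNewformOf V f →
    ∀ (ϖ : ℚ), (if Even (p / 2) then (ϖ : ℝ) * V.realPeriodRat = plusPeriod f
        else (ϖ : ℝ) * V.imaginaryPeriodRat = minusPeriod f) →
    ∀ (Lη : IwasawaAlgebra p), IsQuadraticBranchMinusLFunction f p ϖ Lη →
    PowerSeries.coeff 1 Lη ≠ 0 →
    Finite ↥(strictSelmerPInfty W p) ∧
      (padicValNat p (Nat.card ↥(strictSelmerPInfty W p)) : ℤ) ≤
        ((PowerSeries.coeff 1 Lη : ℤ_[p]) : ℚ_[p]).valuation

/-! ## §4 TYPED INPUT (elementary): every `Ш[p^∞]` class has a strict representative in rank ≥ 1 -/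

/-- **TYPED INPUT (ELEMENTARY, not yet in the kernel; nothing asserted): if `rank_ℤ W(ℚ) ≥ 1`
(so `W(ℚ)` has a point of infinite order, Mordell–Weil) then `#Ш(W)[p^∞] ∣ #Sel_str(W/ℚ)[p^∞]`** (with `Nat.card = 0` for an infinite group,
so the statement is vacuous unless the strict group is finite). Proof to be written next to
`finite_strictSelmer_of_mordellWeilRank_eq_one`: `Sel_{p^∞}(W/ℚ) ↠ Ш(W)[p^∞]` with kernel the Kummer
image `W(ℚ) ⊗ ℚ_p/ℤ_p` (tree `map_primaryH1ToH1_selmerGroupPInfty`, `range_kummerMapPInfty`); the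
localisation of a Selmer class at `p` lies in the local Kummer image `W(ℚ_p) ⊗ ℚ_p/ℤ_p ≅ ℚ_p/ℤ_p`
(`W(ℚ_p) ⊇ A ≅ ℤ_p` of finite index, AEC VII.6.3, tree `exists_finiteIndex_addEquiv_padicInt_holds`),
onto which `W(ℚ) ⊗ ℚ_p/ℤ_p` maps SURJECTIVELY as soon as one rational point has infinite order
(multiplication by a non-zero `p`-adic integer is onto `ℚ_p/ℤ_p`); so every Selmer class is a
strict class plus a Kummer class, i.e. `Sel_str(W/ℚ)[p^∞] ↠ Ш(W)[p^∞]`. (Its kernel is `ℤ/p^ν`,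
`ν` the `p`-divisibility level of the generator in `W(ℚ_p)/tors` — x1b's LOCDIV instrument — not
needed here.) Greenberg LNM 1716 §2 pp. 62–63 (Kummer theory); Kurihara–Pollack 2007 §1.5 (the
fine/strict formulation). [cite: GreenbergLNM1716, §2 (pp. 62–63)] [cite: KuriharaPollack2007, §1.5 (p. 361)] -/
@[conjecture] def StrictSelmerDominatesShaAt (W : WeierstrassCurve ℚ) [W.IsElliptic] (p : ℕ) [Fact p.Prime] :
    Prop :=
  1 ≤ W.mordellWeilRank →
    Nat.card (AddCommGroup.primaryComponent W.sha p) ∣ Nat.card ↥(strictSelmerPInfty W p)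


end Summit.BirchSwinnertonDyer.Rank1Residual.Additive

end
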